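import Literature.MathematicalPhysics.QuantumFieldTheory.Balaban1983to89.Node00.TwoRunSiteKey

/-!
# NODE 00 — THE TWO-RUN SITE LIFT (node U5d, the SECTION of the block-down truncation): blocking UP (preimage under the
# block-down map) carries `s`-cubes EXACTLY onto `(L·s)`-cubes with the same index, unions of cubes to unions of cubes, `𝐃_j` of
# run B's history read one level up to `𝐃^B_{j+1}`; prefixing the whole torus at level 1 lifts every admissible index of the
# cutoff-`K` torus to an admissible run-B index of the cutoff-`(K+1)` torus whose truncation it is — the truncations of
# `Node00/TwoRunSiteTransport` (under `RAgree`) and `Node00/TwoRunSiteKey` (flow-free) are ONTO, and under `RAgree` the two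
# coupling-free key maps of option (b) have the SAME range: no run-A term is without a run-B partner class

Cell `pub-ymgap`, YM-PLAN Track A (HUMAN RULING D-0062); seat `pub-ymgap-dag-n20-d` (R134 (a) N20 NE7b s3) gen 28 — continuation of
`Node00/TwoRunSiteTransport` (gen 26, p561554) and `Node00/TwoRunSiteKey` (gen 27, p570161), answering dag-n19-d's LOCATED-U5d-2 (pub-ymgap
INBOX 2026-08-27, option (α): «a SECTION of the block-down on admissible sequences under `RAgree` — geometry in n20-d's lane»).
[III] = [Balaban1988Convergent], [I] = [Balaban1987RG1].

WHY.  With node U5d's design word of record (node00-def-RR-2: option (b) ADOPTED — `twoRunKeyA := seqKey`, `twoRunKeyB := seqKey ∘ truncShift`),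
N19's keyed class-weight faces (`Thm/BalabanUVNodesN19TargetClassWeightsTwoRunKeyed`, p571597) read the class set `univ.image kA ∪ univ.image kB`;
dag-n19-d's LOCATED-U5d-2: the displayed shell bound and core edge force every GOOD class hit by ONE run only to be pure shell, so every run-A
TERM whose key is not a `kB`-value must be bad or pure shell — an estimate nobody intends — UNLESS `image kA ⊆ image kB`, i.e. unless the
truncation is onto; `TwoRunSiteKey` had only `range kB ⊆ range kA` (`range_twoRunKeyB_subset_of_rAgree`).  The converse is TORUS GEOMETRY:
* §1 the BLOCK-UP of a site set (preimage under `blockDown`): `blockDown` is onto (`blockDownSet_univ`), so `blockDownSet (blockUpSet S) = S`;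
  the preimage of the `s`-cube of index `a` (any collar `n`) is EXACTLY the `(L·s)`-cube of index `a`, collar `n` (cover arithmetic
  `z = L·(z ∕ L) + z mod L`, no divisibility hypothesis), so unions of `s`-cubes block up to unions of `(L·s)`-cubes with the same index set
  (`cubeIndices_mul`) and `𝐃_j` of the history `j ↦ g^B_{j+1}` (cutoff `K`) blocks up INTO `𝐃^B_{j+1}` (cutoff `K+1`) — flow-free; under
  `RAgree` the same for `𝐃^A_j`;
* §2 the whole torus is a union of cubes of every side `s ≥ 1` (`univ_mem_unionsOfCubes`), so `T_η ∈ 𝐃_j` for every history and level;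
* §3 THE SECTION `(Ω_1, …, Ω_k) ↦ (T_η, blockUp Ω_1, …, blockUp Ω_k)` (`liftFun`): the (2.1) chain laws lift (`chain21_liftFun`); `liftShift` is
  a right inverse of the flow-free `truncShift` for EVERY run B (`truncShift_liftShift`, `truncShift_surjective`), `liftSeq` of the
  `RAgree`-truncation `truncSeq` (`truncSeq_liftSeq`, `truncSeq_surjective` — the hypothesis dag-n19-d's consumer displays);
* §4 KEYS: `kB (liftSeq s) = kA s`, so under `RAgree` `range kB = range kA` and `univ.image kB = univ.image kA` — every run-A term has an
  inhabited run-B partner class, B‴ ∕ B⁗'s class set has NO one-sided class on either side; flow-free, `range kB` is EXACTLY the range of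
  the forgetful key of the admissible indices of run B's own history read one level up (`range_twoRunKeyB_eq_range_twoRunKeyA_shift`).
What remains of node U5d's coupling dependence is RR-2's word verbatim: off `RAgree`, the keys of the jump window of `RkOfRecord` are honest
run-B classes of run-A weight `0` — an obligation for the bad-class ∕ shell bounds (N20 ∕ N21), not a typing question.

Nothing of Bałaban's is asserted; no node count moves (typed 28∕28 · discharged 5∕28); N19 ∕ N20 ∕ N21 ∕ N27 NOT discharged; no `sorry`, no
`axiom`, no `instance`, no `notation`; one finite four-torus programme at fixed `ε` — NOT ℝ⁴, NOT OS, NOT a mass gap, NOT the Clay problem.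
-/

noncomputable section

open scoped BigOperators

namespace Literature.MathematicalPhysics.QuantumFieldTheory.Balaban1983to89.Node00

open T4Continuum B14.Eq213MaximalDomains B15Eq112TorusCover B14DomainGeom B14.Eq218Concrete

variable (F : T4Family)

/-! ## §1  Blocking UP: the preimage under the block-down map -/

/-- **THE BLOCK-UP OF A SITE SET**: the preimage, under the block-down map of finest sites `T^{(0)}_{K+1} → T^{(0)}_K`, of a set of
finest sites of the cutoff-`K` torus — the union of the `L`-blocks over it. [cite: Balaban1987RG1, (0.3) p.252 (bookkeeping)] -/
def blockUpSet (K : ℕ) (S : Set (Site (F.P K) 0)) : Set (Site (F.P (K + 1)) 0) :=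
  blockDown F K ⁻¹' S

/-- Membership in the block-up: `x ∈ blockUpSet S ↔ blockDown x ∈ S`. [cite: Balaban1987RG1, (0.3) p.252 (bookkeeping)] -/
theorem mem_blockUpSet_iff (K : ℕ) (S : Set (Site (F.P K) 0)) (x : Site (F.P (K + 1)) 0) :
    x ∈ blockUpSet F K S ↔ blockDown F K x ∈ S :=
  Iff.rfl

/-- `blockUpSet` is monotone (preimages are). [cite: Balaban1987RG1, (0.3) p.252 (bookkeeping)] -/
theorem blockUpSet_mono (K : ℕ) {S T : Set (Site (F.P K) 0)} (h : S ⊆ T) : blockUpSet F K S ⊆ blockUpSet F K T :=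
  Set.preimage_mono h

/-- `blockUpSet ∅ = ∅`. [cite: Balaban1987RG1, (0.3) p.252 (bookkeeping)] -/
@[simp] theorem blockUpSet_empty (K : ℕ) : blockUpSet F K (∅ : Set (Site (F.P K) 0)) = ∅ :=
  rfl

/-- `blockUpSet T_η = T_η`. [cite: Balaban1987RG1, (0.3) p.252 (bookkeeping)] -/
@[simp] theorem blockUpSet_univ (K : ℕ) : blockUpSet F K (Set.univ : Set (Site (F.P K) 0)) = Set.univ :=
  rfl

/-- `blockUpSet` of a finite double-indexed union is the union of the `blockUpSet`s. [cite: Balaban1987RG1, (0.3) p.252 (bookkeeping)] -/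
theorem blockUpSet_biUnion (K : ℕ) {ι : Type*} (A : Finset ι) (S : ι → Set (Site (F.P K) 0)) :
    blockUpSet F K (⋃ a ∈ A, S a) = ⋃ a ∈ A, blockUpSet F K (S a) := by
  unfold blockUpSet; exact Set.preimage_iUnion₂

/-- **THE BLOCK-DOWN MAP IS ONTO** (every finest site of the cutoff-`K` torus is a block). [cite: Balaban1987RG1, (0.3) p.252 (bookkeeping)] -/
theorem blockDown_surjective (K : ℕ) : Function.Surjective (blockDown F K) := by
  rw [← Set.range_eq_univ, ← Set.image_univ]; exact blockDownSet_univ F K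

/-- Blocking down the block-up returns the set: `blockDownSet (blockUpSet S) = S`. [cite: Balaban1987RG1, (0.3) p.252 (bookkeeping)] -/
theorem blockDownSet_blockUpSet (K : ℕ) (S : Set (Site (F.P K) 0)) : blockDownSet F K (blockUpSet F K S) = S :=
  Set.image_preimage_eq S (blockDown_surjective F K)

/-- **CUBES BLOCK UP EXACTLY ONTO CUBES**: the preimage under the block-down map of the `s`-cube of index `a`, enlarged by `n` layers, of run A's
finest lattice IS the `(L·s)`-cube of the SAME index `a`, enlarged by `n` layers, of run B's (no divisibility hypothesis: on the universal covers
`z = L·(z ∕ L) + (z mod L)` coordinatewise, and the deck periods are `2L^{m+K+1} = L · 2L^{m+K}`). [cite: Balaban1988Convergent, (2.17) p.257 (bookkeeping)] -/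
theorem blockUpSet_cubeEnl (K s : ℕ) (a : Pt 4) (n : ℕ) :
    blockUpSet F K (cubeEnl (F.P K) s a n) = cubeEnl (F.P (K + 1)) (F.L * s) a n := by
  refine Set.Subset.antisymm ?_ ?_
  · intro x hx
    rw [mem_blockUpSet_iff] at hx
    have hxz : x = cover (F.P (K + 1)) (lift (F.P (K + 1)) x) := (cover_lift x).symm
    rw [hxz, blockDown_cover] at hx
    obtain ⟨w, hw, hcw⟩ := hx
    have hL0 : (0 : ℤ) < (F.L : ℤ) := by have := F.hL.2; exact_mod_cast (by omega : 0 < F.L)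
    have hdvd : ∀ i, (((F.P K).sitesPerDir 0 : ℕ) : ℤ) ∣ lift (F.P (K + 1)) x i / (F.L : ℤ) - w i := fun i =>
      (ZMod.intCast_eq_intCast_iff_dvd_sub (w i) (lift (F.P (K + 1)) x i / (F.L : ℤ)) ((F.P K).sitesPerDir 0)).1 (congrFun hcw i)
    choose t ht using hdvd
    refine ⟨fun i => (F.L : ℤ) * w i + lift (F.P (K + 1)) x i % (F.L : ℤ), fun i => ?_, ?_⟩
    · obtain ⟨hw1, hw2⟩ := hw i
      have hr0 : 0 ≤ lift (F.P (K + 1)) x i % (F.L : ℤ) := Int.emod_nonneg _ hL0.ne'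
      have hrL : lift (F.P (K + 1)) x i % (F.L : ℤ) < (F.L : ℤ) := Int.emod_lt_of_pos _ hL0
      have h1 := mul_le_mul_of_nonneg_left hw1 hL0.le
      have h2 := mul_le_mul_of_nonneg_left hw2 hL0.le
      push_cast at h1 h2 ⊢
      constructor <;> nlinarith
    · -- `cover z' = cover (lift x) = x`: coordinatewise `lift x μ - z' μ = L · (lift x μ / L - w μ) = (L · N_K) · t μ`
      have key : cover (F.P (K + 1)) (fun i => (F.L : ℤ) * w i + lift (F.P (K + 1)) x i % (F.L : ℤ)) =
          cover (F.P (K + 1)) (lift (F.P (K + 1)) x) := by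
        funext μ
        simp only [cover_apply]
        rw [ZMod.intCast_eq_intCast_iff_dvd_sub, sitesPerDir_zero_succ, Nat.cast_mul]
        refine ⟨t μ, ?_⟩
        have hdecomp := (Int.emod_add_mul_ediv (lift (F.P (K + 1)) x μ) (F.L : ℤ)).symm
        have htμ := ht μ
        linear_combination hdecomp + (F.L : ℤ) * htμ
      rw [key, cover_lift]
  · intro x hx
    rw [mem_blockUpSet_iff, ← blockDownSet_cubeEnl F K s a n]
    exact Set.mem_image_of_mem _ hx

/-- **UNIONS OF CUBES BLOCK UP TO UNIONS OF CUBES** with the same index set: `S ∈ unionsOfCubes s` of run A's finest lattice ⇒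
`blockUpSet S ∈ unionsOfCubes (L·s)` of run B's (`s ≥ 1`). [cite: Balaban1988Convergent, (2.1) p.254 (bookkeeping)] -/
theorem blockUpSet_mem_unionsOfCubes (K : ℕ) {s : ℕ} (hs : 0 < s) {S : Set (Site (F.P K) 0)} (hS : S ∈ unionsOfCubes (F.P K) s) :
    blockUpSet F K S ∈ unionsOfCubes (F.P (K + 1)) (F.L * s) := by
  obtain ⟨A, hA, rfl⟩ := hS
  refine ⟨A, by rwa [cubeIndices_mul F K hs], ?_⟩
  rw [blockUpSet_biUnion]
  refine Set.iUnion₂_congr fun a _ => ?_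
  exact blockUpSet_cubeEnl F K s a 0

/-- The `𝐃_j` cube side of record is positive (`M ≥ 1`; `R_k ≥ 1` always). [cite: Balaban1988Convergent, (2.1) p.254, (2.5) p.255 (bookkeeping)] -/
theorem dCubeSide_rkOfRecord_pos (ν : Stage7Numerics) {M : ℕ} (hM : 0 < M) (g : ℝ) (j : ℕ) :
    0 < dCubeSide F.L M (RkOfRecord F.L ν.r g) j := by
  have hL : 2 ≤ F.L := by have := F.hL.2; omega
  have hR : 0 < RkOfRecord F.L ν.r g := by
    unfold RkOfRecord
    split_ifs
    · exact pow_pos (by omega) _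
    · exact one_pos
  unfold dCubeSide
  exact Nat.mul_pos (Nat.mul_pos (Nat.pow_pos (by omega)) hM) hR

/-- **`𝐃_j` OF RUN B's HISTORY READ ONE LEVEL UP BLOCKS UP INTO `𝐃^B_{j+1}`** — flow-free, EVERY run B: a union of `L^j·M·R(g^B_{j+1})`-cubes
of the cutoff-`K` torus blocks up to a union of `L^{j+1}·M·R(g^B_{j+1})`-cubes of the cutoff-`(K+1)` torus. [cite: Balaban1988Convergent, (2.1) p.254, (2.5) p.255 (bookkeeping)] -/
theorem blockUpSet_mem_dOfRecord_succ (ν : Stage7Numerics) {M : ℕ} (hM : 0 < M) (gB : ℕ → ℝ) (K j : ℕ)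
    {Ω : Set (Site (F.P K) 0)} (hΩ : Ω ∈ DOfRecord F ν M (fun j => gB (j + 1)) K j) :
    blockUpSet F K Ω ∈ DOfRecord F ν M gB (K + 1) (j + 1) := by
  have hΩ' : Ω ∈ unionsOfCubes (F.P K) (dCubeSide F.L M (RkOfRecord F.L ν.r (gB (j + 1))) j) := by
    simpa only [DOfRecord, T4Family.P_L] using hΩ
  simpa only [DOfRecord, T4Family.P_L, dCubeSide_succ] using blockUpSet_mem_unionsOfCubes F K (dCubeSide_rkOfRecord_pos F ν hM (gB (j + 1)) j) hΩ'

/-- Under `RAgree`, `𝐃^A_j` blocks up INTO `𝐃^B_{j+1}` on the window `1 ≤ j ≤ k`. [cite: Balaban1988Convergent, (2.1) p.254, (2.5) p.255 (bookkeeping)] -/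
theorem blockUpSet_mem_dOfRecord_of_rAgree (ν : Stage7Numerics) {M : ℕ} (hM : 0 < M) {gA gB : ℕ → ℝ} {k : ℕ}
    (hR : RAgree F ν gA gB k) {K j : ℕ} (h1 : 1 ≤ j) (hj : j ≤ k) {Ω : Set (Site (F.P K) 0)} (hΩ : Ω ∈ DOfRecord F ν M gA K j) :
    blockUpSet F K Ω ∈ DOfRecord F ν M gB (K + 1) (j + 1) := by
  rw [← dOfRecord_shift_eq_of_rAgree F ν M hR h1 hj] at hΩ
  exact blockUpSet_mem_dOfRecord_succ F ν hM gB K j hΩ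

/-! ## §2  The whole torus is a union of cubes of every side -/

/-- **THE WHOLE TORUS IS A UNION OF CUBES** of every side `s ≥ 1`: `T_η = ⋃_{a ∈ cubeIndices s} □_a` (every site lies in the cube of index
`⌊lift x ∕ s⌋ ∈ cubeIndices s`) — the union form of `B15Claim189CubePin.mem_cubeEnl_cubeOfSite` ∕ `cubeOfSite_mem_cubeIndices`, read through
`B14DomainGeom.cubeIdx`. [cite: Balaban1988Convergent, (2.17) p.257 (bookkeeping)] -/
theorem univ_mem_unionsOfCubes (P : Params) {s : ℕ} (hs : 0 < s) : (Set.univ : Set (Site P 0)) ∈ unionsOfCubes P s := by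
  refine ⟨cubeIndices P s, subset_rfl, (Set.eq_univ_of_forall fun x => ?_).symm⟩
  have hs' : (0 : ℤ) < (s : ℤ) := by exact_mod_cast hs
  -- the cube index of `x`, read on the standard section of the cover
  refine Set.mem_iUnion₂.2 ⟨cubeIdx s (lift P x), ?_, ?_⟩
  · unfold cubeIndices
    rw [Fintype.mem_piFinset]
    intro i
    rw [Finset.mem_image]
    refine ⟨(x i).val / s, ?_, ?_⟩
    · rw [Finset.mem_range]
      have hv : (x i).val < P.sitesPerDir 0 := ZMod.val_lt _
      have h1 : (x i).val / s ≤ (P.sitesPerDir 0 - 1) / s := Nat.div_le_div_right (by omega)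
      have h2 : (P.sitesPerDir 0 + s - 1) / s = (P.sitesPerDir 0 - 1) / s + 1 := by
        rw [show P.sitesPerDir 0 + s - 1 = (P.sitesPerDir 0 - 1) + s by omega, Nat.add_div_right _ hs]
      omega
    · unfold cubeIdx lift
      simp only [Int.natCast_ediv]
  · refine ⟨lift P x, fun i => ?_, cover_lift x⟩
    have hlo := cubeIdx_le s hs (lift P x) i
    have hhi := lt_cubeIdx s hs (lift P x) i
    push_cast
    constructor <;> linarith

/-- Hence `T_η ∈ 𝐃_j` of record for every history, cutoff and level (`M ≥ 1`). [cite: Balaban1988Convergent, (2.1) p.255 (bookkeeping)] -/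
theorem univ_mem_dOfRecord (ν : Stage7Numerics) {M : ℕ} (hM : 0 < M) (g : ℕ → ℝ) (K j : ℕ) :
    (Set.univ : Set (Site (F.P K) 0)) ∈ DOfRecord F ν M g K j := by
  simpa only [DOfRecord, T4Family.P_L] using univ_mem_unionsOfCubes (F.P K) (dCubeSide_rkOfRecord_pos F ν hM (g j) j)

/-! ## §3  The section: prefix the whole torus at level 1, block the other entries up one level -/

/-- **THE LIFTED SEQUENCE OF SITE SETS** `(Ω_1, Ω_2, …) ↦ (T_η, blockUp Ω_1, blockUp Ω_2, …)` (level `0` unused: `∅`). [cite: Balaban1988Convergent, (2.18) p.257 (bookkeeping)] -/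
def liftFun {K : ℕ} (f : ℕ → Set (Site (F.P K) 0)) : ℕ → Set (Site (F.P (K + 1)) 0)
  | 0 => ∅
  | 1 => Set.univ
  | j + 2 => blockUpSet F K (f (j + 1))

/-- Level `1` of the lift is the whole torus. [cite: Balaban1988Convergent, (2.18) p.257 (bookkeeping)] -/
@[simp] theorem liftFun_one {K : ℕ} (f : ℕ → Set (Site (F.P K) 0)) : liftFun F f 1 = Set.univ :=
  rfl

/-- Level `j+1 ≥ 2` of the lift is the block-up of level `j`. [cite: Balaban1988Convergent, (2.18) p.257 (bookkeeping)] -/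
theorem liftFun_succ {K : ℕ} (f : ℕ → Set (Site (F.P K) 0)) {j : ℕ} (h1 : 1 ≤ j) : liftFun F f (j + 1) = blockUpSet F K (f j) := by
  obtain ⟨i, rfl⟩ : ∃ i, j = i + 1 := ⟨j - 1, by omega⟩
  rfl

/-- **THE (2.1) CHAIN LAWS LIFT**: if every class `DA j` on the window blocks up into `𝐃^B_{j+1}`, the lift of a (2.1)-chain of length `k` over `DA`
is a (2.1)-chain of length `k+1` over `𝐃^B` (memberships by hypothesis and `T_η ∈ 𝐃^B_1`; `Λ' ⊆ Ω'`, `Ω'_{j+2} ⊆ Λ'_{j+1}` by monotonicity of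
the preimage; `Ω'_2 ⊆ Λ'_1 = T_η`). [cite: Balaban1988Convergent, (2.1) p.254 (bookkeeping)] -/
theorem chain21_liftFun (ν : Stage7Numerics) {M : ℕ} (hM : 0 < M) (gB : ℕ → ℝ) {K k : ℕ}
    {DA : ℕ → Set (Set (Site (F.P K) 0))} (hD : ∀ j, 1 ≤ j → j ≤ k → ∀ S ∈ DA j, blockUpSet F K S ∈ DOfRecord F ν M gB (K + 1) (j + 1))
    {Ω Λ : ℕ → Set (Site (F.P K) 0)} (h : Chain21 DA k Ω Λ) :
    Chain21 (DOfRecord F ν M gB (K + 1)) (k + 1) (liftFun F Ω) (liftFun F Λ) where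
  memΩ i h1 hi := by
    rcases i with _ | _ | j
    · omega
    · exact univ_mem_dOfRecord F ν hM gB (K + 1) (0 + 1)
    · exact hD (j + 1) (by omega) (by omega) _ (h.memΩ (j + 1) (by omega) (by omega))
  memΛ i h1 hi := by
    rcases i with _ | _ | j
    · omega
    · exact univ_mem_dOfRecord F ν hM gB (K + 1) (0 + 1)
    · exact hD (j + 1) (by omega) (by omega) _ (h.memΛ (j + 1) (by omega) (by omega))
  Λ_subset i h1 hi := by
    rcases i with _ | _ | j
    · omega
    · exact subset_rfl
    · exact blockUpSet_mono F K (h.Λ_subset (j + 1) (by omega) (by omega))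
  Ω_succ_subset i h1 hi := by
    rcases i with _ | _ | j
    · omega
    · exact Set.subset_univ _
    · exact blockUpSet_mono F K (h.Ω_succ_subset (j + 1) (by omega) (by omega))

/-- **THE FLOW-FREE LIFT** (right inverse of `truncShift`, EVERY run B): an admissible index `(Ω_1, …, Ω_k; Λ_1, …, Λ_k)` of the cutoff-`K` torus
over `𝐃` of run B's history read one level up goes to the admissible run-B index `(T_η, blockUp Ω_1, …, blockUp Ω_k; T_η, blockUp Λ_1, …, blockUp Λ_k)`
of the cutoff-`(K+1)` torus. [cite: Balaban1988Convergent, (2.1) p.254, (2.18) p.257 (bookkeeping)] -/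
def liftShift (ν : Stage7Numerics) {M : ℕ} (hM : 0 < M) (gB : ℕ → ℝ) {K k : ℕ}
    (s : Seq (DOfRecord F ν M (fun j => gB (j + 1)) K) k) : Seq (DOfRecord F ν M gB (K + 1)) (k + 1) :=
  Seq.ofChain (liftFun F s.Ω) (liftFun F s.Λ)
    (chain21_liftFun F ν hM gB (fun j _ _ _ hS => blockUpSet_mem_dOfRecord_succ F ν hM gB K j hS) s.chain)

/-- Level `1` of the flow-free lift: `Ω'_1 = T_η`. [cite: Balaban1988Convergent, (2.18) p.257 (bookkeeping)] -/
theorem liftShift_Ω_one (ν : Stage7Numerics) {M : ℕ} (hM : 0 < M) (gB : ℕ → ℝ) {K k : ℕ}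
    (s : Seq (DOfRecord F ν M (fun j => gB (j + 1)) K) k) : (liftShift F ν hM gB s).Ω 1 = Set.univ := by
  unfold liftShift
  rw [Seq.ofChain_Ω _ le_rfl (by omega), liftFun_one]

/-- On the window the flow-free lift reads the index one level down, blocked up: `Ω'_{j+1} = blockUpSet Ω_j`. [cite: Balaban1988Convergent, (2.18) p.257 (bookkeeping)] -/
theorem liftShift_Ω_succ (ν : Stage7Numerics) {M : ℕ} (hM : 0 < M) (gB : ℕ → ℝ) {K k : ℕ}
    (s : Seq (DOfRecord F ν M (fun j => gB (j + 1)) K) k) {j : ℕ} (h1 : 1 ≤ j) (hj : j ≤ k) :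
    (liftShift F ν hM gB s).Ω (j + 1) = blockUpSet F K (s.Ω j) := by
  unfold liftShift
  rw [Seq.ofChain_Ω _ (by omega) (by omega), liftFun_succ F _ h1]

/-- On the window the flow-free lift reads the index one level down, blocked up: `Λ'_{j+1} = blockUpSet Λ_j`. [cite: Balaban1988Convergent, (2.18) p.257 (bookkeeping)] -/
theorem liftShift_Λ_succ (ν : Stage7Numerics) {M : ℕ} (hM : 0 < M) (gB : ℕ → ℝ) {K k : ℕ}
    (s : Seq (DOfRecord F ν M (fun j => gB (j + 1)) K) k) {j : ℕ} (h1 : 1 ≤ j) (hj : j ≤ k) :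
    (liftShift F ν hM gB s).Λ (j + 1) = blockUpSet F K (s.Λ j) := by
  unfold liftShift
  rw [Seq.ofChain_Λ _ (by omega) (by omega), liftFun_succ F _ h1]

/-- **THE FLOW-FREE TRUNCATION OF THE FLOW-FREE LIFT IS THE IDENTITY**: `truncShift (liftShift s) = s`. [cite: Balaban1988Convergent, (2.18) p.257 (bookkeeping)] -/
theorem truncShift_liftShift (ν : Stage7Numerics) {M : ℕ} (hM : 0 < M) (gB : ℕ → ℝ) {K k : ℕ}
    (s : Seq (DOfRecord F ν M (fun j => gB (j + 1)) K) k) : truncShift F ν hM gB (liftShift F ν hM gB s) = s := by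
  apply Seq.ext'
  · funext j
    by_cases hj : 1 ≤ j ∧ j ≤ k
    · rw [truncShift_Ω F ν hM gB _ hj.1 hj.2, liftShift_Ω_succ F ν hM gB s hj.1 hj.2, blockDownSet_blockUpSet]
    · rw [truncShift_Ω_off F ν hM gB _ hj, s.Ω_off j hj]
  · funext j
    by_cases hj : 1 ≤ j ∧ j ≤ k
    · rw [truncShift_Λ F ν hM gB _ hj.1 hj.2, liftShift_Λ_succ F ν hM gB s hj.1 hj.2, blockDownSet_blockUpSet]
    · rw [(truncShift F ν hM gB (liftShift F ν hM gB s)).Λ_off j hj, s.Λ_off j hj]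

/-- **THE FLOW-FREE TRUNCATION IS ONTO**, for EVERY run B. [cite: Balaban1988Convergent, (2.18) p.257 (bookkeeping)] -/
theorem truncShift_surjective (ν : Stage7Numerics) {M : ℕ} (hM : 0 < M) (gB : ℕ → ℝ) {K k : ℕ} :
    Function.Surjective (truncShift F ν hM gB (K := K) (k := k)) :=
  fun s => ⟨liftShift F ν hM gB s, truncShift_liftShift F ν hM gB s⟩

/-- **THE LIFT UNDER `RAgree`** (right inverse of `truncSeq`): an admissible run-A index `(Ω_1, …, Ω_k; Λ_1, …, Λ_k)` over `𝐃^A` goes to the admissible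
run-B index `(T_η, blockUp Ω_1, …, blockUp Ω_k; T_η, blockUp Λ_1, …, blockUp Λ_k)` over `𝐃^B` (memberships transported along the displayed coupling
hypothesis). [cite: Balaban1988Convergent, (2.1) p.254, (2.18) p.257 (bookkeeping)] -/
def liftSeq (ν : Stage7Numerics) {M : ℕ} (hM : 0 < M) {gA gB : ℕ → ℝ} {K k : ℕ} (hR : RAgree F ν gA gB k)
    (s : Seq (DOfRecord F ν M gA K) k) : Seq (DOfRecord F ν M gB (K + 1)) (k + 1) :=
  Seq.ofChain (liftFun F s.Ω) (liftFun F s.Λ)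
    (chain21_liftFun F ν hM gB (fun _ h1 hj _ hS => blockUpSet_mem_dOfRecord_of_rAgree F ν hM hR h1 hj hS) s.chain)

/-- Level `1` of the lift: `Ω'_1 = T_η`. [cite: Balaban1988Convergent, (2.18) p.257 (bookkeeping)] -/
theorem liftSeq_Ω_one (ν : Stage7Numerics) {M : ℕ} (hM : 0 < M) {gA gB : ℕ → ℝ} {K k : ℕ} (hR : RAgree F ν gA gB k)
    (s : Seq (DOfRecord F ν M gA K) k) : (liftSeq F ν hM hR s).Ω 1 = Set.univ := by
  unfold liftSeq
  rw [Seq.ofChain_Ω _ le_rfl (by omega), liftFun_one]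

/-- On the window the lift reads run A one level down, blocked up: `Ω'_{j+1} = blockUpSet Ω_j`. [cite: Balaban1988Convergent, (2.18) p.257 (bookkeeping)] -/
theorem liftSeq_Ω_succ (ν : Stage7Numerics) {M : ℕ} (hM : 0 < M) {gA gB : ℕ → ℝ} {K k : ℕ} (hR : RAgree F ν gA gB k)
    (s : Seq (DOfRecord F ν M gA K) k) {j : ℕ} (h1 : 1 ≤ j) (hj : j ≤ k) :
    (liftSeq F ν hM hR s).Ω (j + 1) = blockUpSet F K (s.Ω j) := by
  unfold liftSeq
  rw [Seq.ofChain_Ω _ (by omega) (by omega), liftFun_succ F _ h1]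

/-- On the window the lift reads run A one level down, blocked up: `Λ'_{j+1} = blockUpSet Λ_j`. [cite: Balaban1988Convergent, (2.18) p.257 (bookkeeping)] -/
theorem liftSeq_Λ_succ (ν : Stage7Numerics) {M : ℕ} (hM : 0 < M) {gA gB : ℕ → ℝ} {K k : ℕ} (hR : RAgree F ν gA gB k)
    (s : Seq (DOfRecord F ν M gA K) k) {j : ℕ} (h1 : 1 ≤ j) (hj : j ≤ k) :
    (liftSeq F ν hM hR s).Λ (j + 1) = blockUpSet F K (s.Λ j) := by
  unfold liftSeq
  rw [Seq.ofChain_Λ _ (by omega) (by omega), liftFun_succ F _ h1]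

/-- **THE `RAgree`-TRUNCATION OF THE LIFT IS THE IDENTITY**: `truncSeq (liftSeq s) = s`. [cite: Balaban1988Convergent, (2.18) p.257 (bookkeeping)] -/
theorem truncSeq_liftSeq (ν : Stage7Numerics) {M : ℕ} (hM : 0 < M) {gA gB : ℕ → ℝ} {K k : ℕ} (hR : RAgree F ν gA gB k)
    (s : Seq (DOfRecord F ν M gA K) k) : truncSeq F ν hM hR (liftSeq F ν hM hR s) = s := by
  apply Seq.ext'
  · funext j
    by_cases hj : 1 ≤ j ∧ j ≤ k
    · rw [truncSeq_Ω F ν hM hR _ hj.1 hj.2, liftSeq_Ω_succ F ν hM hR s hj.1 hj.2, blockDownSet_blockUpSet]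
    · rw [truncSeq_Ω_off F ν hM hR _ hj, s.Ω_off j hj]
  · funext j
    by_cases hj : 1 ≤ j ∧ j ≤ k
    · rw [truncSeq_Λ F ν hM hR _ hj.1 hj.2, liftSeq_Λ_succ F ν hM hR s hj.1 hj.2, blockDownSet_blockUpSet]
    · rw [(truncSeq F ν hM hR (liftSeq F ν hM hR s)).Λ_off j hj, s.Λ_off j hj]

/-- **THE `RAgree`-TRUNCATION IS ONTO** — the displayed hypothesis of dag-n19-d's keyed faces, DISCHARGED. [cite: Balaban1988Convergent, (2.18) p.257 (bookkeeping)] -/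
theorem truncSeq_surjective (ν : Stage7Numerics) {M : ℕ} (hM : 0 < M) {gA gB : ℕ → ℝ} {K k : ℕ} (hR : RAgree F ν gA gB k) :
    Function.Surjective (truncSeq F ν hM hR (K := K)) :=
  fun s => ⟨liftSeq F ν hM hR s, truncSeq_liftSeq F ν hM hR s⟩

/-! ## §4  Keys: under `RAgree` the two key maps of option (b) have the same range -/

/-- **THE LIFT IS A RUN-B PARTNER**: run B's coupling-free key of the lift of `s` is run A's key of `s`, `kB (liftSeq s) = kA s`. [cite: Balaban1988Convergent, (2.18) p.257 (bookkeeping)] -/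
theorem twoRunKeyB_liftSeq (ν : Stage7Numerics) {M : ℕ} (hM : 0 < M) {gA gB : ℕ → ℝ} {K k : ℕ} (hR : RAgree F ν gA gB k)
    (s : SeqOfRecord F ν M gA K k) :
    twoRunKeyB F ν hM gB K k (liftSeq F ν hM hR s) = twoRunKeyA F ν M gA K k s :=
  (twoRunKeyB_eq_twoRunKeyA_iff F ν hM hR _ s).2 (truncSeq_liftSeq F ν hM hR s)

/-- Flow-free: run B's key of the flow-free lift of `s` is the forgetful key of `s`. [cite: Balaban1988Convergent, (2.18) p.257 (bookkeeping)] -/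
theorem twoRunKeyB_liftShift (ν : Stage7Numerics) {M : ℕ} (hM : 0 < M) (gB : ℕ → ℝ) {K k : ℕ}
    (s : SeqOfRecord F ν M (fun j => gB (j + 1)) K k) :
    twoRunKeyB F ν hM gB K k (liftShift F ν hM gB s) = twoRunKeyA F ν M (fun j => gB (j + 1)) K k s := by
  unfold twoRunKeyB twoRunKeyA
  rw [truncShift_liftShift]

/-- **UNDER `RAgree` EVERY RUN-A TERM HAS A RUN-B PARTNER CLASS**: the range of `kA` lies in the range of `kB` (the converse of
`range_twoRunKeyB_subset_of_rAgree`). [cite: Balaban1988Convergent, (2.18) p.257 (bookkeeping)] -/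
theorem range_twoRunKeyA_subset_of_rAgree (ν : Stage7Numerics) {M : ℕ} (hM : 0 < M) {gA gB : ℕ → ℝ} {K k : ℕ}
    (hR : RAgree F ν gA gB k) :
    Set.range (twoRunKeyA F ν M gA K k) ⊆ Set.range (twoRunKeyB F ν hM gB K k) := by
  rintro _ ⟨s, rfl⟩
  exact ⟨liftSeq F ν hM hR s, twoRunKeyB_liftSeq F ν hM hR s⟩

/-- **UNDER `RAgree` THE TWO KEY MAPS HAVE THE SAME RANGE**: `range kB = range kA`. [cite: Balaban1988Convergent, (2.18) p.257 (bookkeeping)] -/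
theorem range_twoRunKeyB_eq_of_rAgree (ν : Stage7Numerics) {M : ℕ} (hM : 0 < M) {gA gB : ℕ → ℝ} {K k : ℕ}
    (hR : RAgree F ν gA gB k) :
    Set.range (twoRunKeyB F ν hM gB K k) = Set.range (twoRunKeyA F ν M gA K k) :=
  Set.Subset.antisymm (range_twoRunKeyB_subset_of_rAgree F ν hM hR) (range_twoRunKeyA_subset_of_rAgree F ν hM hR)

/-- Under `RAgree`, run A's keyed index set lies in run B's: `univ.image kA ⊆ univ.image kB` (the shape dag-n19-d's sigma-packed face consumes,
per cutoff). [cite: Balaban1988Convergent, (2.18) p.257 (bookkeeping)] -/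
theorem image_twoRunKeyA_subset_image_twoRunKeyB_of_rAgree (ν : Stage7Numerics) {M : ℕ} (hM : 0 < M) {gA gB : ℕ → ℝ} {K k : ℕ}
    (hR : RAgree F ν gA gB k) [DecidableEq (SiteSeqKey F K)] :
    Finset.univ.image (twoRunKeyA F ν M gA K k) ⊆ Finset.univ.image (twoRunKeyB F ν hM gB K k) := by
  intro x hx
  obtain ⟨s, -, rfl⟩ := Finset.mem_image.mp hx
  exact Finset.mem_image.mpr ⟨liftSeq F ν hM hR s, Finset.mem_univ _, twoRunKeyB_liftSeq F ν hM hR s⟩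

/-- **UNDER `RAgree` THE TWO KEYED INDEX SETS COINCIDE**: `univ.image kB = univ.image kA` — B‴ ∕ B⁗'s in-file class set has NO one-sided class on
either side. [cite: Balaban1988Convergent, (2.18) p.257 (bookkeeping)] -/
theorem image_twoRunKeyB_eq_image_twoRunKeyA_of_rAgree (ν : Stage7Numerics) {M : ℕ} (hM : 0 < M) {gA gB : ℕ → ℝ} {K k : ℕ}
    (hR : RAgree F ν gA gB k) [DecidableEq (SiteSeqKey F K)] :
    Finset.univ.image (twoRunKeyB F ν hM gB K k) = Finset.univ.image (twoRunKeyA F ν M gA K k) := by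
  refine Finset.Subset.antisymm (fun x hx => ?_) (image_twoRunKeyA_subset_image_twoRunKeyB_of_rAgree F ν hM hR)
  obtain ⟨s', -, rfl⟩ := Finset.mem_image.mp hx
  exact Finset.mem_image.mpr ⟨truncSeq F ν hM hR s', Finset.mem_univ _, (twoRunKeyB_eq_twoRunKeyA_truncSeq F ν hM hR s').symm⟩

/-- Under `RAgree`, the `kB`-fibre over the key of every run-A term is INHABITED (by its lift): run B's partner class of a run-A term is never
empty. [cite: Balaban1988Convergent, (2.18) p.257 (bookkeeping)] -/
theorem filter_twoRunKeyB_eq_twoRunKeyA_nonempty (ν : Stage7Numerics) {M : ℕ} (hM : 0 < M) {gA gB : ℕ → ℝ} {K k : ℕ}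
    (hR : RAgree F ν gA gB k) [DecidableEq (SiteSeqKey F K)] (s : SeqOfRecord F ν M gA K k) :
    (Finset.univ.filter fun s' => twoRunKeyB F ν hM gB K k s' = twoRunKeyA F ν M gA K k s).Nonempty :=
  ⟨liftSeq F ν hM hR s, Finset.mem_filter.mpr ⟨Finset.mem_univ _, twoRunKeyB_liftSeq F ν hM hR s⟩⟩

/-- **FLOW-FREE: RUN B's KEYS ARE EXACTLY THE KEYS OF THE ADMISSIBLE INDICES OF ITS OWN HISTORY READ ONE LEVEL UP** — for EVERY run B, no
hypothesis: `range (kB over g^B) = range (kA over j ↦ g^B_{j+1})`. [cite: Balaban1988Convergent, (2.18) p.257 (bookkeeping)] -/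
theorem range_twoRunKeyB_eq_range_twoRunKeyA_shift (ν : Stage7Numerics) {M : ℕ} (hM : 0 < M) (gB : ℕ → ℝ) (K k : ℕ) :
    Set.range (twoRunKeyB F ν hM gB K k) = Set.range (twoRunKeyA F ν M (fun j => gB (j + 1)) K k) := by
  refine Set.Subset.antisymm ?_ ?_
  · rintro _ ⟨s', rfl⟩
    exact ⟨truncShift F ν hM gB s', rfl⟩
  · rintro _ ⟨s, rfl⟩
    exact ⟨liftShift F ν hM gB s, twoRunKeyB_liftShift F ν hM gB s⟩

end Literature.MathematicalPhysics.QuantumFieldTheory.Balaban1983to89.Node00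

end
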